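import Literature.NumberTheory.LFunctions.TwistedSecondMomentPrimeModulus
import Mathlib.NumberTheory.PrimeCounting
import Mathlib.Topology.Algebra.InfiniteSum.Real
import HarnessLib

/-!
# The sixth moment of Dirichlet `L`-functions at the central point, averaged over the moduli
# `q ≤ Q` with no `t`-average (Chandee–Li–Matomäki–Radziwiłł 2024, Corollary 1.1)

Topic `Literature/NumberTheory/LFunctions` (namespace `Literature.NumberTheory.LFunctions`; the
paper's objects in the sub-namespace `CLMR2024`). STATEMENT LAYER (D-0014): ONE named `Prop`
(`clmr2024Sixth_corollary11`, an unrefereed preprint's result, hence a `[claim …]`, not proved here)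
plus the definitions it needs, every constant verbatim. Typed for the cell `landau-siegel` (rung
F-S3, sub-cell §C harvest, HARVEST row T-055 / P-050; tag E*-len (structured): "the support-2 wall
is not a wall for `d₃`-coefficients with the COMPLETE modulus average (spectral/Kloosterman input);
no transfer to `μ`-type coefficients or to prime-window moduli").

## What the source prints (held text `paper:arxiv-2409.01457`, corpus-tex, 33 chunks, read 2026-08-26)

V. Chandee, X. Li, K. Matomäki, M. Radziwiłł, *The sixth moment of Dirichlet `L`-functions at the
central point*, arXiv:2409.01457 (2024) [ChandeeLiMatomakiRadziwill2024Sixth]. §1 (p0003:L14–18):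
"`Σ_{q ≤ Q} Σ♭_{χ mod q} |L(½, χ)|^{2k} ≪ Q² (log Q)^{k²}`, `k ∈ {1,2,3,4}` [Huxley] … where the
superscript `♭` means that we are only summing over primitive even characters [footnote: The
restriction to even characters is for technical convenience …]."

> **Corollary 1.1** (p0003:L31–43). As `Q → ∞`,
> `Σ_{q ≤ Q} Σ♭_{χ mod q} |L(½, χ)|⁶ ∼ 42 a₃ Σ_{q ≤ Q} ∏_{p ∣ q} (1 − 1/p)⁵/(1 + 4/p + 1/p²) · φ♭(q) (log q)⁹/9!`,
> where `a₃ := ∏_p (1 − 1/p)⁴ (1 + 4/p + 1/p²)`, and `φ♭(q)` counts the number of primitive even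
> characters with modulus `q`.

"Corollary 1.1 quickly follows from Theorem 2.1 by letting the shifts `α_i, β_i` tend to `0`"
(p0006:L123). **Theorem 2.1** (p0006:L113–121; INDEXED ONLY, not typed — it needs the shifted
six-fold objects `σ(m;α)`, `G`, `𝒜`, `𝒵`, `ℬ_q`, `𝒬`, `𝒬̃` of §2): for `Q ≥ 3`, shifts
`α_i, β_i ≪ 1/log Q` with `α_i ≠ β_j`, and any smooth `Ψ` supported on `[1,2]`,
`Σ_q Ψ(q/Q) Σ♭_{χ mod q} Λ(χ; α, β) = Σ_q Ψ(q/Q) φ♭(q) 𝒬̃(q; α, β) + O(Q^{2 − 11/1196 + ε})`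
("we save a power of `11/1196 − ε` in the error term. We have not tried to optimize this saving",
Remark 2.2).

**On `a₃`.** The held arXiv TeX of [ChandeeLiMatomakiRadziwill2024Sixth] prints the first factor of
`a₃` as `(1 − 1/p⁴)` (p0003:L40), with which the product DIVERGES (`∏_p (1 + 4/p + …)`); the
constant meant — "Corollary 1.1 is consistent with the conjectures in [CFKRS]", and the display is
character-for-character that of Conrey–Iwaniec–Soundararajan's Conjecture 2 / Corollary 1 — is
`a₃ = ∏_p (1 − 1/p)⁴ (1 + 4/p + 1/p²)`, the sixth-moment constant of `ζ`, as printed in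
J. B. Conrey, H. Iwaniec, K. Soundararajan, *The sixth power moment of Dirichlet L-functions*, GAFA
22 (2012) = arXiv:0710.5176 [ConreyIwaniecSoundararajan2012SixthMoment], §1, display after
Conjecture 2 (held text p0003:L171–181: "`a₃ = ∏_p (1 − 1/p)⁴ (1 + 4/p + 1/p²)`. Note that `a₃` is
the constant that appears in the conjecture for the sixth moment of `ζ`"). `CLMR2024.a3` below is
THAT (convergent) product; the misprint is recorded here for the referee, not silently repaired in
the statement's meaning (the two displays agree except for this factor).

## Lean rendering / design choices (audit notes for ls-lit-ref)

* `L(½, χ)` = Mathlib `DirichletCharacter.LFunction χ (1/2)`; `|·|⁶ = ‖·‖ ^ 6`.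
* `Σ♭_{χ mod q}` = sum over `χ : DirichletCharacter ℂ q` with `χ.IsPrimitive ∧ χ.Even`; `φ♭(q)` IS
  the tree's `BPRZ2020.evenPrimitiveCount q` (`TwistedSecondMomentPrimeModulus.lean`) — cited, not
  redefined.
* `Σ_{q ≤ Q}`: `q` runs over `1, …, Q`, written `q = i + 1`, `i ∈ range Q` (so that `NeZero q` is
  found by instance search, as in `ThornerZaman2024.zeroCount`); `Q : ℕ` and "`Q → ∞`" is
  `Filter.atTop` on `ℕ` (the printed sum only sees `⌊Q⌋`).
* `∏_{p ∣ q}` = product over `q.primeFactors`; `a₃` = `∏'` over `Nat.Primes` (absolutely convergent: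
  the factor is `1 − 9/p² + O(p⁻³)`, positive for every `p`).
* "`∼`" = the ratio tends to `1` (the right side is positive for `Q ≥ 5`, since `φ♭(5) = 1`; for
  smaller `Q` the ratio is a harmless junk value of a `Tendsto` statement).

WHAT THIS IS NOT: nothing for a single modulus or a short window of moduli (the average over ALL
`q ≤ Q` is essential to the printed proof: "re-write the congruence condition `n ≡ m (mod q)` as
`n ≡ m (mod e)`", §1.1); not the eighth moment (the authors' Duke 173 (2024) companion); no
`t`-average (that is CIS 2012, Theorem 1 / Corollary 1, indexed above for `a₃` only).

## References

* [ChandeeLiMatomakiRadziwill2024Sixth] V. Chandee, X. Li, K. Matomäki, M. Radziwiłł, arXiv:2409.01457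
  (2024), §1 Corollary 1.1 (held text p0003:L31–43), §2 Theorem 2.1 and Remark 2.2 (p0006:L113–123).
* [ConreyIwaniecSoundararajan2012SixthMoment] J. B. Conrey, H. Iwaniec, K. Soundararajan, Geom. Funct.
  Anal. 22 (2012) 1257–1288 = arXiv:0710.5176, §1, Conjecture 2 and the definition of `a₃`
  (p0003:L160–181), Theorem 1 / Corollary 1 (p0004:L1–35).
-/

noncomputable section

open Finset Filter

namespace Literature.NumberTheory.LFunctions

namespace CLMR2024

open scoped Classical in
/-- `Σ♭_{χ mod q} |L(½, χ)|⁶`: the sixth moment of the central values over the primitive EVEN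
Dirichlet characters of modulus `q`. [cite: ChandeeLiMatomakiRadziwill2024Sixth, §1 Corollary 1.1] -/
def sixthMomentAt (q : ℕ) [NeZero q] : ℝ :=
  ∑ χ : DirichletCharacter ℂ q with (χ.IsPrimitive ∧ χ.Even), ‖χ.LFunction (1 / 2)‖ ^ 6

/-- `Σ_{q ≤ Q} Σ♭_{χ mod q} |L(½, χ)|⁶` (`q = i + 1`, `i < Q`).
[cite: ChandeeLiMatomakiRadziwill2024Sixth, §1 Corollary 1.1] -/
def sixthMoment (Q : ℕ) : ℝ :=
  ∑ i ∈ range Q, sixthMomentAt (i + 1)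

/-- **`a₃ = ∏_p (1 − 1/p)⁴ (1 + 4/p + 1/p²)`**, the sixth-moment constant (of `ζ` and of this
family). See the module docstring for the `(1 − 1/p⁴)` misprint in the arXiv TeX of CLMR.
[cite: ConreyIwaniecSoundararajan2012SixthMoment, §1, display after Conjecture 2] -/
def a3 : ℝ :=
  ∏' p : Nat.Primes, (1 - 1 / (p : ℝ)) ^ 4 * (1 + 4 / (p : ℝ) + 1 / (p : ℝ) ^ 2)

/-- The local factor `∏_{p ∣ q} (1 − 1/p)⁵ / (1 + 4/p + 1/p²)` of the main term.
[cite: ChandeeLiMatomakiRadziwill2024Sixth, §1 Corollary 1.1] -/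
def localFactor (q : ℕ) : ℝ :=
  ∏ p ∈ q.primeFactors, (1 - 1 / (p : ℝ)) ^ 5 / (1 + 4 / (p : ℝ) + 1 / (p : ℝ) ^ 2)

/-- The printed main term `42 a₃ Σ_{q ≤ Q} ∏_{p ∣ q} (1 − 1/p)⁵/(1 + 4/p + 1/p²) · φ♭(q) (log q)⁹/9!`
(`φ♭ = BPRZ2020.evenPrimitiveCount`; `q = i + 1`, `i < Q`).
[cite: ChandeeLiMatomakiRadziwill2024Sixth, §1 Corollary 1.1] -/
def mainTerm (Q : ℕ) : ℝ :=
  42 * a3 * ∑ i ∈ range Q,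
    localFactor (i + 1) * (BPRZ2020.evenPrimitiveCount (i + 1) : ℝ) *
      Real.log ((i : ℝ) + 1) ^ 9 / (Nat.factorial 9 : ℝ)

end CLMR2024

/-- **Chandee–Li–Matomäki–Radziwiłł 2024, Corollary 1.1** (NAMED `Prop`, AS PRINTED; unrefereed
preprint ⇒ `claim`). As `Q → ∞`,
`Σ_{q ≤ Q} Σ♭_{χ mod q} |L(½, χ)|⁶ ∼ 42 a₃ Σ_{q ≤ Q} ∏_{p ∣ q} (1 − 1/p)⁵/(1 + 4/p + 1/p²) φ♭(q) (log q)⁹/9!`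
— the sixth moment of Dirichlet `L`-functions at the central point over primitive even characters
and ALL moduli `q ≤ Q`, unconditionally and with no `t`-average (removing the `t`-average of
Conrey–Iwaniec–Soundararajan 2012); rendered as "the ratio tends to `1`". Status: theorem-in-print
(preprint), not proved here (spectral theory of automorphic forms + Deligne's bounds for
hyper-Kloosterman sums for the unbalanced `d₃ ⊗ d₃` sums, §1.1 of the source).
[claim: ChandeeLiMatomakiRadziwill2024Sixth, status: under-review] -/
def clmr2024Sixth_corollary11 : Prop :=
  Tendsto (fun Q : ℕ => CLMR2024.sixthMoment Q / CLMR2024.mainTerm Q) atTop (nhds 1)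

namespace CLMR2024

/-- Every summand of the sixth moment is non-negative, so `sixthMoment` is monotone in `Q`
(bookkeeping for consumers comparing `⌊Q⌋`-sums at real `Q`). [cite: ChandeeLiMatomakiRadziwill2024Sixth, §1 Corollary 1.1] -/
theorem sixthMomentAt_nonneg (q : ℕ) [NeZero q] : 0 ≤ sixthMomentAt q := by
  classical
  unfold sixthMomentAt
  exact Finset.sum_nonneg fun χ _ => by positivity

/-- `Q ↦ Σ_{q ≤ Q} Σ♭ |L(½,χ)|⁶` is monotone. [cite: ChandeeLiMatomakiRadziwill2024Sixth, §1 Corollary 1.1] -/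
theorem sixthMoment_mono : Monotone sixthMoment := by
  intro Q Q' h
  unfold sixthMoment
  exact Finset.sum_le_sum_of_subset_of_nonneg (Finset.range_mono h)
    (fun i _ _ => sixthMomentAt_nonneg (i + 1))

/-- The local factor is positive (each `p ≥ 2`). [cite: ChandeeLiMatomakiRadziwill2024Sixth, §1 Corollary 1.1] -/
theorem localFactor_pos (q : ℕ) : 0 < localFactor q := by
  unfold localFactor
  refine Finset.prod_pos fun p hp => ?_
  have hp2 : (2 : ℝ) ≤ p := by exact_mod_cast (Nat.prime_of_mem_primeFactors hp).two_le
  have h1 : 0 < 1 - 1 / (p : ℝ) := by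
    rw [sub_pos, div_lt_one (by linarith)]; linarith
  positivity

end CLMR2024

end Literature.NumberTheory.LFunctions

end
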